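import Mathlib.Analysis.Complex.Exponential
import Mathlib.Analysis.SpecialFunctions.Complex.Circle
import Mathlib.MeasureTheory.Integral.Bochner.ContinuousLinearMap
import Literature.Probability.LatticeModels.MMPInequality
import Literature.Combinatorics.Digraph.RivasseauBalancedSubgraphs
import HarnessLib

/-!
# Monomial characters of the torus `U(1)^V` and the graphical expansion of products of cosines

The "graphical exercise" behind the high-temperature / Taylor expansions of the plane-rotator model (E. H. Lieb,
*A refinement of Simon's correlation inequality*, Comm. Math. Phys. 77 (1980) 127–135 [Lieb1980], p. 133: "A
possibility would be to try to imitate the graphical proof that is successful in the Ising case. It would then be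
necessary to deal with directed graphs"; J. Ginibre, Comm. Math. Phys. 16 (1970) 310, Example 4), in the tree's
torus vocabulary (`torusHaar`, `diffChar`, `cosDiff` of `DisorderedXYModel.lean` / `MMPInequality.lean`) and the
digraph vocabulary of `Literature.Combinatorics.Digraph.RivasseauBalancedSubgraphs` (`arrowCharge`, `orient`,
`valence`):

* `torusMonomial q θ = ∏_v θ_v^{q_v}` (`q : V → ℤ`), the monomial characters; multiplicativity in `q` and `θ`;
  `diffChar x y = torusMonomial (e_y − e_x)` (`diffChar_eq_torusMonomial`).
* **Orthogonality** (`integral_torusMonomial`): `∫ ∏_v θ_v^{q_v} dθ = [q = 0]` for the Haar probability measure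
  (translation by a root of `−1` in a coordinate where `q ≠ 0`).
* **Expansion of a product of cosines** (`prod_coe_cosDiff_eq`): writing each `cos(θ_y − θ_x) = ½(e^{i(θ_y−θ_x)} +
  e^{−i(θ_y−θ_x)})`, `∏_i cos(θ_{y_i} − θ_{x_i}) = 2^{−n} ∑_σ ∏_v θ_v^{valence_σ(v)}`, the sum over the `2^n`
  ORIENTATIONS `σ` of the pairs, the exponent being the valence (in-degree minus out-degree) of the resulting
  directed multigraph.
* **The counting formula** (`integral_cosDiff_mul_prod_cosDiff`): for pairs `(x_i, y_i)_{i ∈ α}` and two vertices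
  `x, y`, `∫ cos(θ_x − θ_y) ∏_i cos(θ_{y_i} − θ_{x_i}) dθ = 2^{−|α|} · #{σ : valence_σ = e_x − e_y}` — the number of
  orientations making the directed multigraph carry one unit of current from `y` to `x` (balanced when `x = y`).
  The symmetry `σ ↦ ¬σ` (`card_filter_valence_eq_neg`) identifies the two halves of `cos(θ_x − θ_y)`.

Use: the Taylor coefficients of `Z⟨cos(θ_a − θ_c)⟩` for `exp(∑ J cos)` weights are these counts; Rivasseau's lemma
compares them (Lieb's inequality (23) for rotors, `PlaneRotatorLiebRivasseauProof.lean`). Not here: Bessel-function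
(integer-current) resummations; infinite volume.
-/

noncomputable section

open MeasureTheory Finset
open scoped BigOperators ComplexConjugate

namespace Literature.Probability.LatticeModels

open Literature.Combinatorics.Digraph

/-! ### Monomial characters -/

section Monomial

variable {V : Type*} [Fintype V]

/-- The monomial character `θ ↦ ∏_v θ_v^{q_v}` of the torus `U(1)^V` with exponent vector `q : V → ℤ` (Lieb 1980,
Example 2: `φ^n(θ) = exp(inθ)`, and (6): products over the sites). [cite: Lieb1980, Example 2 and eq. (6)] -/
def torusMonomial (q : V → ℤ) (θ : V → Circle) : Circle :=
  ∏ v, θ v ^ q v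

/-- The trivial character. [cite: Lieb1980, Example 2 (n = 0)] -/
theorem torusMonomial_zero (θ : V → Circle) : torusMonomial 0 θ = 1 := by
  simp [torusMonomial]

/-- Multiplicativity in the exponent. [cite: Lieb1980, eq. (6) (products of the φⁿ)] -/
theorem torusMonomial_add (q q' : V → ℤ) (θ : V → Circle) :
    torusMonomial (q + q') θ = torusMonomial q θ * torusMonomial q' θ := by
  simp only [torusMonomial, Pi.add_apply, zpow_add, Finset.prod_mul_distrib]

/-- Negating the exponent inverts (conjugates) the character. [cite: Lieb1980, Example 2 (n and −n)] -/
theorem torusMonomial_neg (q : V → ℤ) (θ : V → Circle) : torusMonomial (-q) θ = (torusMonomial q θ)⁻¹ := by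
  simp only [torusMonomial, Pi.neg_apply, zpow_neg, Finset.prod_inv_distrib]

/-- Multiplicativity in the exponent, finite sums. [cite: Lieb1980, eq. (6) (products of the φⁿ)] -/
theorem torusMonomial_sum {α : Type*} (s : Finset α) (q : α → V → ℤ) (θ : V → Circle) :
    torusMonomial (∑ i ∈ s, q i) θ = ∏ i ∈ s, torusMonomial (q i) θ := by
  classical
  induction s using Finset.induction_on with
  | empty => rw [Finset.sum_empty, Finset.prod_empty, torusMonomial_zero]
  | insert a s ha ih => rw [Finset.sum_insert ha, Finset.prod_insert ha, torusMonomial_add, ih]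

/-- The monomial character is a character: multiplicative in `θ`. [cite: Lieb1980, Example 2] -/
theorem torusMonomial_mul (q : V → ℤ) (θ φ : V → Circle) :
    torusMonomial q (θ * φ) = torusMonomial q θ * torusMonomial q φ := by
  simp only [torusMonomial, Pi.mul_apply, mul_zpow, Finset.prod_mul_distrib]

/-- A monomial supported at one site. [cite: Lieb1980, Example 2] -/
theorem torusMonomial_single [DecidableEq V] (v : V) (n : ℤ) (θ : V → Circle) :
    torusMonomial (Pi.single v n) θ = θ v ^ n := by
  unfold torusMonomial
  rw [Finset.prod_eq_single v (fun b _ hb => by rw [Pi.single_eq_of_ne hb, zpow_zero])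
    (fun h => absurd (Finset.mem_univ v) h), Pi.single_eq_same]

/-- The monomial characters are continuous. [cite: Lieb1980, Example 2] -/
theorem continuous_torusMonomial (q : V → ℤ) : Continuous fun θ : V → Circle => torusMonomial q θ :=
  continuous_finsetProd _ fun v _ => (continuous_apply v).zpow (q v)

/-- The inclusion `U(1) → ℂ` is multiplicative over finite products. [folklore] -/
private theorem coe_finset_prod {α : Type*} (s : Finset α) (f : α → Circle) :
    (((∏ i ∈ s, f i : Circle)) : ℂ) = ∏ i ∈ s, (f i : ℂ) :=
  map_prod Circle.coeHom f s

/-- `if true …` and `if false …` for `Bool`-indexed sums. [folklore] -/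
private theorem ite_bool_true_false {β : Type*} (a b : β) :
    ((if true then a else b) = a) ∧ ((if false then a else b) = b) :=
  ⟨rfl, rfl⟩

/-- The relative-angle character `θ̄_x θ_y` is the monomial with exponent the arrow charge `e_y − e_x`.
[cite: Lieb1980, p. 132 (σ_a·σ_b in terms of the φⁿ)] -/
theorem diffChar_eq_torusMonomial [DecidableEq V] (x y : V) (θ : V → Circle) :
    diffChar x y θ = torusMonomial (arrowCharge (x, y)) θ := by
  rw [arrowCharge, sub_eq_add_neg, torusMonomial_add, torusMonomial_neg, torusMonomial_single,
    torusMonomial_single, zpow_one, zpow_one, diffChar_apply, mul_comm]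

/-- The cosine `cos(θ_x − θ_y) = ½ (∏_v θ_v^{(e_y − e_x)_v} + ∏_v θ_v^{−(e_y − e_x)_v})` as the average of the two
oriented monomials. [cite: Lieb1980, p. 132 (σ_a·σ_c = ½(φ¹φ⁻¹ + φ⁻¹φ¹))] -/
theorem coe_cosDiff_eq [DecidableEq V] (x y : V) (θ : V → Circle) :
    (cosDiff x y θ : ℂ) = (1 / 2 : ℂ) *
      (((torusMonomial (arrowCharge (x, y)) θ : Circle) : ℂ) + ((torusMonomial (-arrowCharge (x, y)) θ : Circle) : ℂ)) := by
  rw [torusMonomial_neg, ← diffChar_eq_torusMonomial, Circle.coe_inv_eq_conj, cosDiff_eq_reChar, reChar,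
    Complex.re_eq_add_conj]
  ring

/-- The cosine of a pair `p = (x, y)` as the average over its two ORIENTATIONS `b ∈ {true, false}` of the oriented
monomials (the form that expands products over orientations). [cite: Lieb1980, p. 132 (σ_a·σ_c = ½(φ¹φ⁻¹ + φ⁻¹φ¹))] -/
theorem coe_cosDiff_pair_eq [DecidableEq V] (p : V × V) (θ : V → Circle) :
    (cosDiff p.1 p.2 θ : ℂ) = (1 / 2 : ℂ) *
      ∑ b : Bool, ((torusMonomial (if b then arrowCharge p else -arrowCharge p) θ : Circle) : ℂ) := by
  rw [Fintype.sum_bool, (ite_bool_true_false _ _).1, (ite_bool_true_false _ _).2]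
  exact coe_cosDiff_eq p.1 p.2 θ

variable [DecidableEq V]

/-- **Expansion of a product of cosines over orientations**: for pairs `g i = (x_i, y_i)`,
`∏_i cos(θ_{y_i} − θ_{x_i}) = 2^{−|α|} ∑_{σ : α → Bool} ∏_v θ_v^{valence(orient g σ)(v)}` — each choice of signs is an
orientation of the pairs and the exponent collects into the valence of the directed multigraph.
[cite: Lieb1980, p. 133 (expansion into directed graphs)] -/
theorem prod_coe_cosDiff_eq {α : Type*} [Fintype α] [DecidableEq α] (g : α → V × V) (θ : V → Circle) :
    ∏ i, (cosDiff (g i).1 (g i).2 θ : ℂ) =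
      (1 / 2 : ℂ) ^ Fintype.card α *
        ∑ σ : α → Bool, ((torusMonomial (valence (orient g σ) Finset.univ) θ : Circle) : ℂ) := by
  simp_rw [coe_cosDiff_pair_eq]
  rw [Finset.prod_mul_distrib, Finset.prod_const, Finset.card_univ, Finset.prod_univ_sum,
    Fintype.piFinset_univ]
  congr 1
  refine Finset.sum_congr rfl fun σ _ => ?_
  rw [valence_orient, torusMonomial_sum, coe_finset_prod]

end Monomial

/-! ### Orthogonality and the counting formula -/

section Integral

variable {V : Type*} [Fintype V] [DecidableEq V] [MeasurableSpace Circle] [BorelSpace Circle]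

/-- **Orthogonality of the monomial characters**: `∫_{U(1)^V} ∏_v θ_v^{q_v} dθ = 1` if `q = 0` and `= 0` otherwise
(Haar probability measure; translation invariance against a root of `−1` at a site where `q ≠ 0`).
[cite: Lieb1980, eq. (6) (orthonormality of the φⁿ_B)] -/
theorem integral_torusMonomial (q : V → ℤ) :
    ∫ θ, ((torusMonomial q θ : Circle) : ℂ) ∂torusHaar V = if q = 0 then 1 else 0 := by
  split_ifs with hq
  · simp [hq, torusMonomial_zero]
  · obtain ⟨v, hv⟩ : ∃ v, q v ≠ 0 := by
      by_contra h
      push Not at h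
      exact hq (funext h)
    set w : Circle := Circle.exp (Real.pi / q v) with hw
    set φ : V → Circle := Pi.mulSingle v w with hφ
    have hφq : ((torusMonomial q φ : Circle) : ℂ) = -1 := by
      have h1 : torusMonomial q φ = w ^ q v := by
        unfold torusMonomial
        rw [Finset.prod_eq_single v (fun b _ hb => by rw [hφ, Pi.mulSingle_eq_of_ne hb, one_zpow])
          (fun h => absurd (Finset.mem_univ v) h), hφ, Pi.mulSingle_eq_same]
      rw [h1, Circle.coe_zpow, hw, Circle.coe_exp, ← Complex.exp_int_mul, ← Complex.exp_pi_mul_I]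
      congr 1
      have : (q v : ℂ) ≠ 0 := by exact_mod_cast hv
      push_cast
      field_simp
    have h := integral_torusHaar_mul_right (fun θ => ((torusMonomial q θ : Circle) : ℂ)) φ
    simp only [torusMonomial_mul, Circle.coe_mul, hφq, mul_neg_one, integral_neg] at h
    exact neg_eq_self.mp h

/-- An oriented monomial times a product of cosines integrates to a count of orientations:
`∫ ∏_v θ_v^{q₀ v} ∏_i cos(θ_{y_i} − θ_{x_i}) dθ = 2^{−|α|} #{σ : q₀ + valence(orient g σ) = 0}`.
[cite: Lieb1980, p. 133 (expansion into directed graphs)] -/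
theorem integral_torusMonomial_mul_prod_cosDiff {α : Type*} [Fintype α] [DecidableEq α] (q₀ : V → ℤ)
    (g : α → V × V) :
    ∫ θ, ((torusMonomial q₀ θ : Circle) : ℂ) * ∏ i, (cosDiff (g i).1 (g i).2 θ : ℂ) ∂torusHaar V =
      (1 / 2 : ℂ) ^ Fintype.card α *
        ((Finset.univ.filter fun σ : α → Bool => q₀ + valence (orient g σ) Finset.univ = 0).card : ℂ) := by
  have hpt : ∀ θ : V → Circle,
      ((torusMonomial q₀ θ : Circle) : ℂ) * ∏ i, (cosDiff (g i).1 (g i).2 θ : ℂ) =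
        ∑ σ : α → Bool, (1 / 2 : ℂ) ^ Fintype.card α *
          ((torusMonomial (q₀ + valence (orient g σ) Finset.univ) θ : Circle) : ℂ) := by
    intro θ
    rw [prod_coe_cosDiff_eq, Finset.mul_sum, Finset.mul_sum]
    refine Finset.sum_congr rfl fun σ _ => ?_
    rw [torusMonomial_add, Circle.coe_mul]
    ring
  have hint : ∀ σ : α → Bool, Integrable (fun θ : V → Circle =>
      (1 / 2 : ℂ) ^ Fintype.card α * ((torusMonomial (q₀ + valence (orient g σ) Finset.univ) θ : Circle) : ℂ))
      (torusHaar V) := fun σ =>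
    integrable_torusHaar_of_continuous
      (continuous_const.mul (continuous_subtype_val.comp (continuous_torusMonomial _)))
  simp_rw [hpt]
  rw [integral_finsetSum _ fun σ _ => hint σ]
  simp_rw [integral_const_mul, integral_torusMonomial, ← Finset.mul_sum, Finset.sum_boole]

omit [MeasurableSpace Circle] [BorelSpace Circle] in
/-- **The sign-flip symmetry**: reversing every orientation negates the valence, so the orientations with valence
`q` and with valence `−q` are equinumerous. [cite: Lieb1980, p. 133 (expansion into directed graphs)] -/
theorem card_filter_valence_eq_neg {α : Type*} [Fintype α] [DecidableEq α] (g : α → V × V) (q : V → ℤ) :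
    (Finset.univ.filter fun σ : α → Bool => valence (orient g σ) Finset.univ = -q).card =
      (Finset.univ.filter fun σ : α → Bool => valence (orient g σ) Finset.univ = q).card := by
  have hinj : Function.Injective fun σ : α → Bool => fun i => !σ i := by
    intro σ τ h
    funext i
    have := congrFun h i
    simpa using this
  rw [← Finset.card_image_of_injective
    (Finset.univ.filter fun σ : α → Bool => valence (orient g σ) Finset.univ = q) hinj]
  congr 1
  ext τ
  simp only [Finset.mem_filter, Finset.mem_univ, true_and, Finset.mem_image]
  constructor
  · intro hτ
    refine ⟨fun i => !τ i, ?_, funext fun i => by simp⟩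
    rw [valence_orient_not, hτ, neg_neg]
  · rintro ⟨σ, hσ, rfl⟩
    rw [valence_orient_not, hσ]

/-- **The counting formula for a two-point insertion**: for vertices `x, y` and pairs `g i = (x_i, y_i)`,
`∫ cos(θ_x − θ_y) ∏_i cos(θ_{y_i} − θ_{x_i}) dθ = 2^{−|α|} · #{σ : valence(orient g σ) = e_x − e_y}` — the number
of orientations of the pairs whose directed multigraph has valence `+1` at `x`, `−1` at `y`, `0` elsewhere
(balanced when `x = y`, where `cos(θ_x − θ_x) = 1`). These are the Taylor coefficients of the plane-rotator two-point
function. [cite: Lieb1980, p. 133 (the graphical exercise, directed graphs)] -/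
theorem integral_cosDiff_mul_prod_cosDiff {α : Type*} [Fintype α] [DecidableEq α] (x y : V) (g : α → V × V) :
    ∫ θ, cosDiff x y θ * ∏ i, cosDiff (g i).1 (g i).2 θ ∂torusHaar V =
      ((Finset.univ.filter fun σ : α → Bool =>
          valence (orient g σ) Finset.univ = Pi.single x 1 - Pi.single y 1).card : ℝ) / 2 ^ Fintype.card α := by
  apply Complex.ofReal_injective
  rw [← integral_complex_ofReal]
  push_cast
  have hpt : ∀ θ : V → Circle, (cosDiff x y θ : ℂ) * ∏ i, (cosDiff (g i).1 (g i).2 θ : ℂ) =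
      (1 / 2 : ℂ) * (((torusMonomial (arrowCharge (x, y)) θ : Circle) : ℂ) *
          ∏ i, (cosDiff (g i).1 (g i).2 θ : ℂ)) +
        (1 / 2 : ℂ) * (((torusMonomial (-arrowCharge (x, y)) θ : Circle) : ℂ) *
          ∏ i, (cosDiff (g i).1 (g i).2 θ : ℂ)) := by
    intro θ
    rw [coe_cosDiff_eq x y]
    ring
  simp_rw [hpt]
  have hi : ∀ q : V → ℤ, Integrable (fun θ : V → Circle => (1 / 2 : ℂ) *
      (((torusMonomial q θ : Circle) : ℂ) * ∏ i, (cosDiff (g i).1 (g i).2 θ : ℂ))) (torusHaar V) := fun q =>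
    integrable_torusHaar_of_continuous (continuous_const.mul
      ((continuous_subtype_val.comp (continuous_torusMonomial _)).mul
        (continuous_finsetProd _ fun i _ => Complex.continuous_ofReal.comp (continuous_cosDiff _ _))))
  rw [integral_add (hi _) (hi _), integral_const_mul, integral_const_mul, integral_torusMonomial_mul_prod_cosDiff,
    integral_torusMonomial_mul_prod_cosDiff]
  have h1 : (Finset.univ.filter fun σ : α → Bool => arrowCharge (x, y) + valence (orient g σ) Finset.univ = 0) =
      Finset.univ.filter fun σ : α → Bool =>
        valence (orient g σ) Finset.univ = Pi.single x 1 - Pi.single y 1 := by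
    refine Finset.filter_congr fun σ _ => ?_
    rw [arrowCharge, add_comm, add_eq_zero_iff_eq_neg, neg_sub]
  have h2 : (Finset.univ.filter fun σ : α → Bool => -arrowCharge (x, y) + valence (orient g σ) Finset.univ = 0) =
      Finset.univ.filter fun σ : α → Bool =>
        valence (orient g σ) Finset.univ = -(Pi.single x 1 - Pi.single y 1) := by
    refine Finset.filter_congr fun σ _ => ?_
    rw [arrowCharge, neg_add_eq_zero, eq_comm, neg_sub]
  rw [h1, h2, card_filter_valence_eq_neg]
  have h2n : (1 / 2 : ℂ) ^ Fintype.card α = 1 / 2 ^ Fintype.card α := by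
    rw [one_div, one_div, inv_pow]
  rw [h2n]
  ring

end Integral

end Literature.Probability.LatticeModels

end
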